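import Literature.Barriers.CriticalPhenomena.RigorousRGSmallParameterCovarianceMassDerivative
import HarnessLib

/-!
# `RigorousRGSmallParameter` (Slade, Theorem 1.4.1): Proposition 3.3.1, the `∂/∂m²` display —
# `|∂C_{j;0,x}/∂m²| ≲ L^{ε(j-1)}(m²L^{α(j-1)})^{-r_d}` below the mass scale (`q = 1` case of §10.1)

Companion of `RigorousRGSmallParameterCovarianceMassDerivative.lean` (`∂ρ/∂A`, `∂C_j/∂m²` under
the Kato integral, Lemma 10.1.4 with `q = 1`) and `RigorousRGSmallParameterCovarianceBound.lean`
(the `q = 0` case, whose three-regime architecture is repeated here). Source: G. Slade, *Critical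
exponents for long-range `O(n)` models below the upper critical dimension*, Commun. Math. Phys.
**358** (2018) 343–436, arXiv:1611.06169, Proposition 3.3.1 / Proposition 10.1.1: "Let `d = 1,2,3`.
For `m²L^{α(j-1)} ∈ (0,1]`, for `α ∈ (½,1)` when `d = 1`, and for `α ∈ (1,2)` when `d = 2,3`,
`|∂/∂m² ∇^aC_{j;x,y}| ≤ cL^{(ε-|a|)(j-1)} × (m²L^{α(j-1)})^{-(2-1/α)}` (`d = 1`),
`(m²L^{α(j-1)})^{-(2-2/α)}|log(m²L^{α(j-1)})|` (`d = 2`), `(m²L^{α(j-1)})^{-(2-2/α)}` (`d = 3`). The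
constant `c` may depend on `ā, p'`, but does not depend on `m², L, j, N`", and its proof in §10.1
with `q = 1`: "`z = 2β(1+q) = α(1+q)` … (10.16) `T_{j,1} ≲ L^{-(d-z+|a|)(j-1)}I_1(γ_d,β,q,A_j)` …
(10.17) `T_{j,2} ≲ L^{-(d-z+|a|)(j-1)}I_2(β-p,β,q,A_j)` … (10.18) `T_{j,3} ≲ L^{-(d-z+|a|)(j-1)}L^{-p'(j-1)}
I_2(β-1,β,q,A)` … For the `I_1` term, we have `r_d = 1 - 1/(2β) + q` (`d = 1`), `1 - 1/β + q`
(`d = 2,3`), so … `r_1 > 0` if `q = 1` … (10.24) For `A_j ≤ 1`, the above gives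
`|∂/∂A ∇^aC_{j;0,x}| ≲ L^{(ε-|a|)(j-1)} λ_d(A_j)/A_j^{r_d}`".

## What this file proves (everything; no definition and no named fact is introduced)

* `FRD.massDeriv_integral_le_core` — the `q = 1` estimate
  `∫₀^∞|Γ_{j;0,x}(s)|s^β/(s^β+m²)³ds ≤ c(L^{j-1})^{2α-d}A_j^{-r}`, `A_j = m²(L^{j-1})^α ≤ 1`, `m² > 0`,
  `r = 2 - (1-θ)/β`, parametrised by the exponent `θ` of the `t`-integral of Lemma 10.1.3 (a
  hypothesis), valid when `α + θ > 1`; `FRD.abs_deriv_fracCov_le_of_core` — the passage to the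
  derivative through `|∂ρ/∂A| ≲ s^β/(s^β+A)³`.
* **`FRD.Slade2017_prop331_massDeriv_d1`** — the printed display for `d = 1`, `a = 0`, on `ℤ¹`:
  `α ∈ (½,1)`, exponent `2 - 1/α`, PROVED.
* **`FRD.Slade2017_prop331_massDeriv_dge3`** — the printed display for `d = 3` (indeed all
  `d ≥ 3`), `a = 0`: `α ∈ (1,2)`, exponent `2 - 2/α`, PROVED.
* **`FRD.Slade2017_prop331_massDeriv_d2`** — `d = 2`, `a = 0`, `α ∈ (1,2)`: for every `θ ∈ (0,1]`,
  exponent `2 - 2/α + 2θ/α`, PROVED. Scope: the printed `d = 2` statement carries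
  `|log(m²L^{α(j-1)})|` instead of the extra power `A_j^{-2θ/α}`; the power form is what the
  corrected `1 + log s⁻¹` bound of Lemma 10.1.3 (`CovBound.setIntegral_inv_mul_one_add_mul_sq_le`,
  `CovBound.log_le_rpow_neg`) gives and what the paper uses downstream (proof of Lemma 5.2.4: "To
  deal with the logarithmic factor in (5.23) for `d = 2`, we increase `r` slightly to absorb it").
In all three the derivative exists (`hasDerivAt_fracCov_mass`) and `c` is independent of
`m², L, j, x`. Not treated: gradients `∇^a` (`a ≠ 0`), the torus covariance `C_{N,N}`, and the
regime `A_j > 1` (for which the printed proof gives `1/(1+A_j³) + 1/(1+A²L^{p'(j-1)})`).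
-/

noncomputable section

namespace Literature.Barriers.CriticalPhenomena

open _root_.MeasureTheory Set Filter
open scoped _root_.Topology Real

namespace LongRangePhi4

namespace FRD

open Literature.Probability.LatticeModels

variable {d : ℕ}

/-! ### The `q = 1` estimate of Proposition 10.1.1: `|∂C_{j;0,x}/∂m²|` below the mass scale -/

open scoped FourierTransform

/-- **The core of the `q = 1` case of the proof of Proposition 10.1.1**, parametrised by the
exponent `θ` of the `t`-integral of Lemma 10.1.3 (`∫_{J_1}(dt/t)(1+σt²)^{-1}t^{2-d} ≤ K₁σ^{-θ}` for
`σ ≤ 1`, a hypothesis here: `θ = ½` for `d = 1`, any `θ > 0` for `d = 2`, `θ = 0` for `d ≥ 3`): for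
`m² > 0`, `A_j = m²(L^{j-1})^α ≤ 1`, `L ≥ 2`, `j ≥ 1`, `x ∈ ℤ^d`,
`∫₀^∞ |Γ_{j;0,x}(s)| s^β/(s^β+m²)³ ds ≤ c (L^{j-1})^{2α-d} A_j^{-r}`, `r = 2 - (1-θ)/β`, `β = α/2`,
provided `α + θ > 1` (which is `r > 0` and makes `γ_d = β - θ` admissible in `I_1(γ_d,β,1,A_j)`).
The proof is the printed one with `q = 1` (`z = 2α`): `Γ_j = R + 𝟙_{j=1}S` (10.6); the `s`-integral
is split at `L^{-2(j-1)}` and `1`; on the three pieces (10.8) with `p = 1`, `p = 2`, `p = 1`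
respectively and the bounds `I_1(β-θ,β,1,·) ≲ A^{-r}` (the scaling bound), `I_2(β-2,β,1,·) ≲
T^{-2β-1}`, `I_2(β-1,β,1,·) ≲ 1` of Lemma 10.1.4 with `q = 1`; the power counting gives the common
factor `L^{(4β-d)(j-1)} = L^{ε(j-1)}` ((10.22)–(10.24)).
[cite: Slade2017, §10.1 (proof of Proposition 10.1.1 with q = 1: displays (10.11)–(10.18), (10.19)–(10.24))] -/
theorem massDeriv_integral_le_core (hd : 1 ≤ d) {α : ℝ} (hα0 : 0 < α) (hα2 : α < 2)
    {θ K₁ : ℝ} (hθ0 : 0 ≤ θ) (hαθ : 1 < α + θ) (hθ1 : θ ≤ 1) (hK₁ : 0 < K₁)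
    (hJ₁ : ∀ σ : ℝ, 0 < σ → σ ≤ 1 → ∀ L : ℝ, 1 ≤ L →
      ∫ τ in Ioc (1 / 2 : ℝ) (L / 2), ((1 + σ * τ ^ 2) ^ 1)⁻¹ * (τ ^ 2 / τ ^ d) / τ ≤ K₁ * σ ^ (-θ)) :
    ∃ c : ℝ, 0 < c ∧ ∀ L : ℝ, 2 ≤ L → ∀ m2 : ℝ, 0 < m2 → ∀ j : ℕ, 1 ≤ j → ∀ x : Site d,
      m2 * (L ^ (j - 1)) ^ α ≤ 1 →
      ∫ s in Ioi 0, |Gam d L s j x| * (s ^ (α / 2) / (s ^ (α / 2) + m2) ^ 3) ≤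
        c * (L ^ (j - 1)) ^ (2 * α - d) * (m2 * (L ^ (j - 1)) ^ α) ^ (-(2 - (1 - θ) / (α / 2))) := by
  -- parameters
  set β : ℝ := α / 2 with hβ
  have hβ0 : 0 < β := by positivity
  have hβ1 : β < 1 := by rw [hβ]; linarith
  have hαβ : α = 2 * β := by rw [hβ]; ring
  set r : ℝ := 2 - (1 - θ) / β with hr
  have hγ1 : -1 < β - θ := by linarith
  have hγr : β - θ + 1 < 3 * β := by
    have : 1 - θ < 2 * β := by rw [hβ]; linarith
    linarith
  have hr0 : 0 < r := by
    rw [hr, sub_pos, div_lt_iff₀ hβ0]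
    linarith
  have hr3 : 3 - (β - θ + 1) / β = r := by
    rw [hr]
    field_simp
    ring
  -- the bounds (10.8) on `w`
  obtain ⟨c₁, hc₁, hw₁⟩ := Slade2017_display108_small_mass hd 1
  obtain ⟨c₂, hc₂, hw₂⟩ := Slade2017_display108_small_mass hd 2
  obtain ⟨c₃, hc₃, hw₃⟩ := Slade2017_display108_large_mass hd 1
  -- the `t`-integrals over `J_1`
  obtain ⟨K₂, hK₂, hJ₂⟩ := exists_setIntegral_J_sq_le hd
  obtain ⟨K₃, hK₃, hJ₃⟩ := exists_setIntegral_J_pow_le hd (p := 1) le_rfl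
  -- constants
  set κ : ℝ := |(𝓕 (profile : ℝ → ℂ) 0).re / (2 * π * cProfile)| with hκ
  have hκ0 : 0 ≤ κ := abs_nonneg _
  set M₁ : ℝ := c₁ * K₁ + κ / 2 with hM₁
  set M₂ : ℝ := c₂ * K₂ + κ / 2 with hM₂
  set M₃ : ℝ := c₃ * K₃ + κ / 2 with hM₃
  have hM₁0 : 0 < M₁ := by positivity
  have hM₂0 : 0 < M₂ := by positivity
  have hM₃0 : 0 < M₃ := by positivity
  obtain ⟨Kc, hKc⟩ : ∃ K : ℝ, K = 1 / (β - θ + 1) + 1 / (3 * β - (β - θ) - 1) := ⟨_, rfl⟩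
  have hKc0 : 0 < Kc := by
    have h1 : 0 < β - θ + 1 := by linarith
    have h2 : 0 < 3 * β - (β - θ) - 1 := by linarith
    rw [hKc]
    positivity
  set a₁ : ℝ := M₁ * Kc with ha₁
  set a₂ : ℝ := M₂ / (2 * β + 1) with ha₂
  set a₃ : ℝ := M₃ / (2 * β) with ha₃
  have ha₁0 : 0 < a₁ := by positivity
  have ha₂0 : 0 < a₂ := by positivity
  have ha₃0 : 0 < a₃ := by positivity
  refine ⟨a₁ + a₂ + a₃, by positivity, fun L hL m2 hm2 j hj x hAj1 => ?_⟩
  -- notation for this `L, m², j, x`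
  have hL1 : (1 : ℝ) ≤ L := by linarith
  set A : ℝ := m2 with hA
  have hA0 : 0 < A := hm2
  set ℓ : ℝ := L ^ (j - 1) with hℓ
  have hℓ1 : 1 ≤ ℓ := one_le_pow₀ hL1
  have hℓ0 : 0 < ℓ := by linarith
  have hℓj : j = 1 → ℓ = 1 := fun h => by rw [hℓ, h]; simp
  set T : ℝ := (ℓ ^ 2)⁻¹ with hT
  have hT0 : 0 < T := by positivity
  have hT1 : T ≤ 1 := inv_le_one_of_one_le₀ (one_le_pow₀ hℓ1)
  set P : ℝ := ℓ ^ (2 * α - d : ℝ) with hP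
  have hP0 : 0 < P := Real.rpow_pos_of_pos hℓ0 _
  set Aj : ℝ := A * ℓ ^ α with hAj
  have hAj0 : 0 < Aj := mul_pos hA0 (Real.rpow_pos_of_pos hℓ0 _)
  have hAjr : 1 ≤ Aj ^ (-r) := Real.one_le_rpow_of_pos_of_le_one_of_nonpos hAj0 hAj1 (by linarith)
  -- the integrand
  set f : ℝ → ℝ := fun s => |Gam d L s j x| * (s ^ β / (s ^ β + A) ^ 3) with hf
  have hfrac0 : ∀ s : ℝ, 0 < s → 0 ≤ s ^ β / (s ^ β + A) ^ 3 := fun s hs =>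
    div_nonneg (Real.rpow_nonneg hs.le _) (pow_nonneg (by
      have := Real.rpow_pos_of_pos hs β; linarith) 3)
  clear_value f P T a₁ a₂ a₃ M₁ M₂ M₃ κ
  show ∫ s in Ioi 0, f s ≤ (a₁ + a₂ + a₃) * P * Aj ^ (-r)
  by_cases hint : IntegrableOn f (Ioi 0)
  swap
  · rw [integral_undef hint]
    positivity
  -- Step 1: `Γ_j = R + 𝟙_{j=1}S` (10.6), and pointwise bounds on `|Γ_j(s)|` in the three regimes
  have hGam : ∀ s : ℝ, 0 < s → Gam d L s j x =
      (∫ t in Ioc (ℓ / 2) (ℓ * L / 2), wKer d s t x / t) +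
        (if j = 1 then ∫ t in Ioc 0 (1 / 2), wKer d s t x / t else 0) := fun s hs => by
    have := Gam_eq_regular_add hL1 hs hj x
    rwa [← hℓ] at this
  have hfac : 0 ≤ ℓ ^ 2 / ℓ ^ d := by positivity
  have hfac1 : j = 1 → ℓ ^ 2 / ℓ ^ d = 1 := fun h => by rw [hℓj h]; simp
  have hSle : ∀ s : ℝ, 0 < s → j = 1 →
      |∫ t in Ioc 0 (1 / 2), wKer d s t x / t| ≤ κ / 2 * s⁻¹ ∧
      |∫ t in Ioc 0 (1 / 2), wKer d s t x / t| ≤ κ / 2 := by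
    intro s hs _
    have h := abs_special_le hs x
    rw [← hκ] at h
    have hd' : (1 : ℝ) ≤ d := by exact_mod_cast hd
    constructor
    · refine h.trans (mul_le_mul_of_nonneg_left ?_ (by positivity))
      rw [one_div]
      exact inv_anti₀ hs (by linarith)
    · refine h.trans (mul_le_of_le_one_right (by positivity) ?_)
      rw [div_le_one (by positivity)]
      linarith
  -- (i) `s ≤ T = L^{-2(j-1)}` (hence `sℓ² ≤ 1`): (10.8) with `p = 1`
  have hG1 : ∀ s : ℝ, 0 < s → s ≤ T →
      |Gam d L s j x| ≤ M₁ * (ℓ ^ 2 / ℓ ^ d) * (s * ℓ ^ 2) ^ (-θ) := by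
    intro s hs hsT
    have hs1 : s ≤ 1 := hsT.trans hT1
    have hσ1 : s * ℓ ^ 2 ≤ 1 := by
      have := mul_le_mul_of_nonneg_right hsT (sq_nonneg ℓ)
      rwa [hT, inv_mul_cancel₀ (by positivity)] at this
    have hσ0 : 0 < s * ℓ ^ 2 := by positivity
    have hR := abs_regular_le_of_small_mass hw₁ hL1 hℓ1 hs hs1 x
    have hJ := hJ₁ (s * ℓ ^ 2) hσ0 hσ1 L hL1
    have hpow1 : 1 ≤ (s * ℓ ^ 2) ^ (-θ) :=
      Real.one_le_rpow_of_pos_of_le_one_of_nonpos hσ0 hσ1 (by linarith)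
    have hSb : |(if j = 1 then ∫ t in Ioc 0 (1 / 2), wKer d s t x / t else 0)| ≤
        κ / 2 * (ℓ ^ 2 / ℓ ^ d) * (s * ℓ ^ 2) ^ (-θ) := by
      rcases eq_or_ne j 1 with h1 | h1
      · rw [if_pos h1, hfac1 h1, mul_one]
        exact ((hSle s hs h1).2).trans (le_mul_of_one_le_right (by positivity) hpow1)
      · rw [if_neg h1, abs_zero]
        positivity
    rw [hGam s hs]
    calc |(∫ t in Ioc (ℓ / 2) (ℓ * L / 2), wKer d s t x / t) +
          (if j = 1 then ∫ t in Ioc 0 (1 / 2), wKer d s t x / t else 0)|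
        ≤ |∫ t in Ioc (ℓ / 2) (ℓ * L / 2), wKer d s t x / t| +
          |(if j = 1 then ∫ t in Ioc 0 (1 / 2), wKer d s t x / t else 0)| := abs_add_le _ _
      _ ≤ c₁ * (ℓ ^ 2 / ℓ ^ d) * (K₁ * (s * ℓ ^ 2) ^ (-θ)) +
          κ / 2 * (ℓ ^ 2 / ℓ ^ d) * (s * ℓ ^ 2) ^ (-θ) := by
          refine add_le_add (hR.trans ?_) hSb
          refine mul_le_mul_of_nonneg_left ?_ (by positivity)
          exact hJ
      _ = M₁ * (ℓ ^ 2 / ℓ ^ d) * (s * ℓ ^ 2) ^ (-θ) := by rw [hM₁]; ring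
  -- (ii) `s ≤ 1`: (10.8) with `p = 2`
  have hG2 : ∀ s : ℝ, 0 < s → s ≤ 1 →
      |Gam d L s j x| ≤ M₂ * (ℓ ^ 2 / ℓ ^ d) * ((s * ℓ ^ 2) ^ 2)⁻¹ := by
    intro s hs hs1
    have hσ0 : 0 < s * ℓ ^ 2 := by positivity
    have hR := abs_regular_le_of_small_mass hw₂ hL1 hℓ1 hs hs1 x
    have hJ := hJ₂ (s * ℓ ^ 2) hσ0 L hL1
    have hSb : |(if j = 1 then ∫ t in Ioc 0 (1 / 2), wKer d s t x / t else 0)| ≤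
        κ / 2 * (ℓ ^ 2 / ℓ ^ d) * ((s * ℓ ^ 2) ^ 2)⁻¹ := by
      rcases eq_or_ne j 1 with h1 | h1
      · rw [if_pos h1, hfac1 h1, mul_one, hℓj h1]
        have hpow1 : 1 ≤ ((s * 1 ^ 2) ^ 2)⁻¹ := by
          rw [one_pow, mul_one, one_le_inv₀ (by positivity)]
          exact pow_le_one₀ hs.le hs1
        exact ((hSle s hs h1).2).trans (le_mul_of_one_le_right (by positivity) hpow1)
      · rw [if_neg h1, abs_zero]
        positivity
    rw [hGam s hs]
    calc |(∫ t in Ioc (ℓ / 2) (ℓ * L / 2), wKer d s t x / t) +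
          (if j = 1 then ∫ t in Ioc 0 (1 / 2), wKer d s t x / t else 0)|
        ≤ |∫ t in Ioc (ℓ / 2) (ℓ * L / 2), wKer d s t x / t| +
          |(if j = 1 then ∫ t in Ioc 0 (1 / 2), wKer d s t x / t else 0)| := abs_add_le _ _
      _ ≤ c₂ * (ℓ ^ 2 / ℓ ^ d) * (K₂ * ((s * ℓ ^ 2) ^ 2)⁻¹) +
          κ / 2 * (ℓ ^ 2 / ℓ ^ d) * ((s * ℓ ^ 2) ^ 2)⁻¹ := by
          refine add_le_add (hR.trans ?_) hSb
          refine mul_le_mul_of_nonneg_left ?_ (by positivity)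
          exact hJ
      _ = M₂ * (ℓ ^ 2 / ℓ ^ d) * ((s * ℓ ^ 2) ^ 2)⁻¹ := by rw [hM₂]; ring
  -- (iii) `s ≥ 1`: (10.8), third regime, with `p = 1`
  have hG3 : ∀ s : ℝ, 1 ≤ s →
      |Gam d L s j x| ≤ M₃ * s⁻¹ * ((ℓ ^ (2 * 1))⁻¹ * (ℓ ^ 2 / ℓ ^ d)) := by
    intro s hs1
    have hs : 0 < s := by linarith
    have hR := abs_regular_le_of_large_mass hw₃ hL1 hℓ1 hs1 x
    have hJ := hJ₃ L hL1
    have hfac3 : 0 ≤ (ℓ ^ (2 * 1))⁻¹ * (ℓ ^ 2 / ℓ ^ d) := by positivity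
    have hSb : |(if j = 1 then ∫ t in Ioc 0 (1 / 2), wKer d s t x / t else 0)| ≤
        κ / 2 * s⁻¹ * ((ℓ ^ (2 * 1))⁻¹ * (ℓ ^ 2 / ℓ ^ d)) := by
      rcases eq_or_ne j 1 with h1 | h1
      · rw [if_pos h1, hfac1 h1, mul_one, hℓj h1, one_pow, inv_one, mul_one]
        exact (hSle s hs h1).1
      · rw [if_neg h1, abs_zero]
        positivity
    rw [hGam s hs]
    calc |(∫ t in Ioc (ℓ / 2) (ℓ * L / 2), wKer d s t x / t) +
          (if j = 1 then ∫ t in Ioc 0 (1 / 2), wKer d s t x / t else 0)|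
        ≤ |∫ t in Ioc (ℓ / 2) (ℓ * L / 2), wKer d s t x / t| +
          |(if j = 1 then ∫ t in Ioc 0 (1 / 2), wKer d s t x / t else 0)| := abs_add_le _ _
      _ ≤ c₃ * s⁻¹ * ((ℓ ^ (2 * 1))⁻¹ * (ℓ ^ 2 / ℓ ^ d)) * K₃ +
          κ / 2 * s⁻¹ * ((ℓ ^ (2 * 1))⁻¹ * (ℓ ^ 2 / ℓ ^ d)) :=
          add_le_add (hR.trans (mul_le_mul_of_nonneg_left hJ (by positivity))) hSb
      _ = M₃ * s⁻¹ * ((ℓ ^ (2 * 1))⁻¹ * (ℓ ^ 2 / ℓ ^ d)) := by rw [hM₃]; ring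
  -- Step 2: `|f| = |Γ_j| s^β/(s^β+A)³`
  have hf_abs : ∀ s : ℝ, 0 < s → |f s| = |Gam d L s j x| * (s ^ β / (s ^ β + A) ^ 3) :=
    fun s hs => by simp only [hf]; rw [abs_mul, abs_abs, abs_of_nonneg (hfrac0 s hs)]
  have hfg : ∀ {s G X e : ℝ}, 0 < s → 0 ≤ G → |Gam d L s j x| ≤ G * X → X * s ^ β = s ^ e →
      |f s| ≤ G * (s ^ e / (s ^ β + A) ^ 3) := by
    intro s G X e hs hG hGX hX
    rw [hf_abs s hs]
    have hD : 0 ≤ ((s ^ β + A) ^ 3)⁻¹ := inv_nonneg.2 (pow_nonneg (by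
      have := Real.rpow_pos_of_pos hs β; linarith) 3)
    calc |Gam d L s j x| * (s ^ β / (s ^ β + A) ^ 3)
        ≤ G * X * (s ^ β / (s ^ β + A) ^ 3) := mul_le_mul_of_nonneg_right hGX (hfrac0 s hs)
      _ = G * (X * s ^ β / (s ^ β + A) ^ 3) := by ring
      _ = G * (s ^ e / (s ^ β + A) ^ 3) := by rw [hX]
  -- power counting
  have hℓ2 : 0 < ℓ ^ 2 := by positivity
  have hPle : ∀ e : ℝ, e ≤ 2 * α - d → ℓ ^ e ≤ P := fun e he => by
    rw [hP]
    exact Real.rpow_le_rpow_of_exponent_le hℓ1 he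
  -- `A^{-r} = A_j^{-r} (ℓ²)^{βr}` and the piece-1 power identity
  have hAr : A ^ (-r) = Aj ^ (-r) * (ℓ ^ 2) ^ (β * r) := by
    have hℓα : 0 < ℓ ^ α := Real.rpow_pos_of_pos hℓ0 _
    rw [hAj, Real.mul_rpow hA0.le hℓα.le, mul_assoc, ← Real.rpow_natCast ℓ 2,
      ← Real.rpow_mul hℓ0.le, ← Real.rpow_mul hℓ0.le, ← Real.rpow_add hℓ0]
    have : α * -r + (2 : ℕ) * (β * r) = 0 := by rw [hαβ]; push_cast; ring
    rw [this, Real.rpow_zero, mul_one]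
  have hP1 : ℓ ^ 2 / ℓ ^ d * (ℓ ^ 2) ^ (-θ) * (ℓ ^ 2) ^ (β * r) = P := by
    have e : (ℓ ^ 2) ^ (β * r) = ((ℓ ^ 2)⁻¹) ^ (-(β * r)) := by
      rw [Real.inv_rpow hℓ2.le, ← Real.rpow_neg hℓ2.le, neg_neg]
    rw [e, rpow_combine hℓ0, hP]
    congr 1
    rw [hr, hαβ]
    field_simp
    ring
  have hP2 : ℓ ^ 2 / ℓ ^ d * (ℓ ^ 2) ^ (-2 : ℝ) * ((ℓ ^ 2)⁻¹) ^ (β - 2 - 3 * β + 1) = P := by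
    rw [rpow_combine hℓ0, hP]
    congr 1
    rw [hαβ]
    ring
  have hP3 : (ℓ ^ (2 * 1))⁻¹ * (ℓ ^ 2 / ℓ ^ d) ≤ P := by
    have e : (ℓ ^ (2 * 1))⁻¹ * (ℓ ^ 2 / ℓ ^ d) = ℓ ^ (-(d : ℝ)) := by
      rw [mul_one, Real.rpow_neg hℓ0.le, Real.rpow_natCast]
      field_simp
    rw [e]
    exact hPle _ (by linarith)
  -- piece 1: `(0, T]`
  obtain ⟨G₁, hG₁⟩ : ∃ G : ℝ, G = M₁ * ((ℓ ^ 2 / ℓ ^ d) * (ℓ ^ 2) ^ (-θ)) := ⟨_, rfl⟩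
  have hG₁0 : 0 ≤ G₁ := by
    rw [hG₁]
    exact mul_nonneg hM₁0.le (mul_nonneg hfac (Real.rpow_nonneg hℓ2.le _))
  have hg1 : ∀ s ∈ Ioc (0 : ℝ) T, |f s| ≤ G₁ * (s ^ (β - θ) / (s ^ β + A) ^ 3) := by
    intro s hs
    refine hfg (X := s ^ (-θ)) hs.1 hG₁0 ?_ ?_
    · have := hG1 s hs.1 hs.2
      rw [Real.mul_rpow hs.1.le hℓ2.le] at this
      calc |Gam d L s j x| ≤ M₁ * (ℓ ^ 2 / ℓ ^ d) * (s ^ (-θ) * (ℓ ^ 2) ^ (-θ)) := this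
        _ = G₁ * s ^ (-θ) := by rw [hG₁]; ring
    · rw [← Real.rpow_add hs.1]
      congr 1
      ring
  have hi1 := CovBound.integrableOn_rpow_div_cube_Ioc (β := β) hγ1 hA0 hT0.le
  have hpiece1 : |∫ s in Ioc 0 T, f s| ≤ a₁ * P * Aj ^ (-r) := by
    have hsub : Ioc (0 : ℝ) T ⊆ Ioi 0 := fun s hs => Set.mem_Ioi.2 hs.1
    have hgi : IntegrableOn (fun s : ℝ => G₁ * (s ^ (β - θ) / (s ^ β + A) ^ 3)) (Ioc 0 T) :=
      hi1.const_mul G₁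
    have hb0 := abs_setIntegral_le_of_abs_le (f := f) measurableSet_Ioc (hint.mono_set hsub) hgi hg1
    have he0 : ∫ s in Ioc 0 T, G₁ * (s ^ (β - θ) / (s ^ β + A) ^ 3) =
        G₁ * ∫ s in Ioc 0 T, s ^ (β - θ) / (s ^ β + A) ^ 3 := integral_const_mul _ _
    have hb := hb0.trans_eq he0
    have h1 := CovBound.setIntegral_rpow_div_cube_Ioc_le_rpow_neg T hβ0 hγ1 hγr hA0
    rw [hr3, ← hKc] at h1
    calc |∫ s in Ioc 0 T, f s| ≤ G₁ * ∫ s in Ioc 0 T, s ^ (β - θ) / (s ^ β + A) ^ 3 := hb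
      _ ≤ G₁ * (Kc * A ^ (-r)) := mul_le_mul_of_nonneg_left h1 hG₁0
      _ = M₁ * Kc * (ℓ ^ 2 / ℓ ^ d * (ℓ ^ 2) ^ (-θ) * (ℓ ^ 2) ^ (β * r)) * Aj ^ (-r) := by
          rw [hG₁, hAr]; ring
      _ = a₁ * P * Aj ^ (-r) := by rw [hP1, ha₁]
  -- piece 2: `(T, 1]`
  obtain ⟨G₂, hG₂⟩ : ∃ G : ℝ, G = M₂ * ((ℓ ^ 2 / ℓ ^ d) * (ℓ ^ 2) ^ (-2 : ℝ)) := ⟨_, rfl⟩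
  have hG₂0 : 0 ≤ G₂ := by
    rw [hG₂]
    exact mul_nonneg hM₂0.le (mul_nonneg hfac (Real.rpow_nonneg hℓ2.le _))
  have hg2 : ∀ s ∈ Ioc T 1, |f s| ≤ G₂ * (s ^ (β - 2) / (s ^ β + A) ^ 3) := by
    intro s hs
    have hs0 : 0 < s := lt_trans hT0 hs.1
    refine hfg (X := (s ^ 2)⁻¹) hs0 hG₂0 ?_ ?_
    · have := hG2 s hs0 hs.2
      calc |Gam d L s j x| ≤ M₂ * (ℓ ^ 2 / ℓ ^ d) * ((s * ℓ ^ 2) ^ 2)⁻¹ := this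
        _ = G₂ * (s ^ 2)⁻¹ := by
            rw [hG₂, Real.rpow_neg hℓ2.le, Real.rpow_two, mul_pow, mul_inv]
            ring
    · rw [← Real.rpow_two, ← Real.rpow_neg hs0.le, ← Real.rpow_add hs0]
      congr 1
      ring
  have hγ2 : β - 2 - 3 * β < -1 := by linarith
  have hi2 := CovBound.integrableOn_rpow_div_cube_Ioi hγ2 hA0.le hT0
  have hnn2 : 0 ≤ᵐ[volume.restrict (Ioi T)] fun s : ℝ => s ^ (β - 2) / (s ^ β + A) ^ 3 := by
    refine (ae_restrict_iff' measurableSet_Ioi).2 (Eventually.of_forall fun s hs => ?_)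
    have hs0 : (0 : ℝ) < s := lt_trans hT0 (Set.mem_Ioi.1 hs)
    exact div_nonneg (Real.rpow_nonneg hs0.le _) (pow_nonneg (by
      have := Real.rpow_pos_of_pos hs0 β; linarith) 3)
  have hpiece2 : |∫ s in Ioc T 1, f s| ≤ a₂ * P * Aj ^ (-r) := by
    have hsub : Ioc T 1 ⊆ Ioi 0 := fun s hs => Set.mem_Ioi.2 (lt_trans hT0 hs.1)
    have hgi : IntegrableOn (fun s : ℝ => G₂ * (s ^ (β - 2) / (s ^ β + A) ^ 3)) (Ioc T 1) :=
      (hi2.mono_set Ioc_subset_Ioi_self).const_mul G₂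
    have hb0 := abs_setIntegral_le_of_abs_le (f := f) measurableSet_Ioc (hint.mono_set hsub) hgi hg2
    have he0 : ∫ s in Ioc T 1, G₂ * (s ^ (β - 2) / (s ^ β + A) ^ 3) =
        G₂ * ∫ s in Ioc T 1, s ^ (β - 2) / (s ^ β + A) ^ 3 := integral_const_mul _ _
    have hb := hb0.trans_eq he0
    have hb' : |∫ s in Ioc T 1, f s| ≤ G₂ * ∫ s in Ioi T, s ^ (β - 2) / (s ^ β + A) ^ 3 :=
      hb.trans (mul_le_mul_of_nonneg_left (setIntegral_mono_set hi2 hnn2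
        (Eventually.of_forall fun s (hs : s ∈ Ioc T 1) => (hs.1 : s ∈ Ioi T))) hG₂0)
    have h1 := CovBound.setIntegral_rpow_div_cube_Ioi_le hγ2 hA0.le hT0
    have hden : 3 * β - (β - 2) - 1 = 2 * β + 1 := by ring
    rw [hden] at h1
    calc |∫ s in Ioc T 1, f s| ≤ G₂ * ∫ s in Ioi T, s ^ (β - 2) / (s ^ β + A) ^ 3 := hb'
      _ ≤ G₂ * (T ^ (β - 2 - 3 * β + 1) / (2 * β + 1)) := mul_le_mul_of_nonneg_left h1 hG₂0
      _ = M₂ / (2 * β + 1) * (ℓ ^ 2 / ℓ ^ d * (ℓ ^ 2) ^ (-2 : ℝ) *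
            ((ℓ ^ 2)⁻¹) ^ (β - 2 - 3 * β + 1)) := by rw [hG₂, hT]; ring
      _ = a₂ * P := by rw [hP2, ha₂]
      _ ≤ a₂ * P * Aj ^ (-r) := le_mul_of_one_le_right (by positivity) hAjr
  -- piece 3: `(1, ∞)`
  obtain ⟨G₃, hG₃⟩ : ∃ G : ℝ, G = M₃ * ((ℓ ^ (2 * 1))⁻¹ * (ℓ ^ 2 / ℓ ^ d)) := ⟨_, rfl⟩
  have hG₃0 : 0 ≤ G₃ := by
    rw [hG₃]
    exact mul_nonneg hM₃0.le (mul_nonneg (inv_nonneg.2 (pow_nonneg hℓ0.le _)) hfac)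
  have hg3 : ∀ s ∈ Ioi (1 : ℝ), |f s| ≤ G₃ * (s ^ (β - 1) / (s ^ β + A) ^ 3) := by
    intro s hs
    have hs1 : (1 : ℝ) ≤ s := le_of_lt (Set.mem_Ioi.1 hs)
    have hs0 : 0 < s := lt_of_lt_of_le zero_lt_one hs1
    refine hfg (X := s⁻¹) hs0 hG₃0 ?_ ?_
    · calc |Gam d L s j x| ≤ M₃ * s⁻¹ * ((ℓ ^ (2 * 1))⁻¹ * (ℓ ^ 2 / ℓ ^ d)) := hG3 s hs1
        _ = G₃ * s⁻¹ := by rw [hG₃]; ring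
    · rw [← Real.rpow_neg_one, ← Real.rpow_add hs0]
      congr 1
      ring
  have hγ3 : β - 1 - 3 * β < -1 := by linarith only [hβ0]
  have hi3 := CovBound.integrableOn_rpow_div_cube_Ioi hγ3 hA0.le zero_lt_one
  have hpiece3 : |∫ s in Ioi 1, f s| ≤ a₃ * P * Aj ^ (-r) := by
    have hsub : Ioi (1 : ℝ) ⊆ Ioi 0 := fun s hs => Set.mem_Ioi.2 (lt_trans zero_lt_one (Set.mem_Ioi.1 hs))
    have hgi : IntegrableOn (fun s : ℝ => G₃ * (s ^ (β - 1) / (s ^ β + A) ^ 3)) (Ioi 1) :=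
      hi3.const_mul G₃
    have hb0 := abs_setIntegral_le_of_abs_le (f := f) measurableSet_Ioi (hint.mono_set hsub) hgi hg3
    have he0 : ∫ s in Ioi (1 : ℝ), G₃ * (s ^ (β - 1) / (s ^ β + A) ^ 3) =
        G₃ * ∫ s in Ioi (1 : ℝ), s ^ (β - 1) / (s ^ β + A) ^ 3 := integral_const_mul _ _
    have hb := hb0.trans_eq he0
    have h1 := CovBound.setIntegral_rpow_div_cube_Ioi_le hγ3 hA0.le zero_lt_one
    rw [Real.one_rpow] at h1
    have hden : 3 * β - (β - 1) - 1 = 2 * β := by ring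
    rw [hden] at h1
    calc |∫ s in Ioi 1, f s| ≤ G₃ * ∫ s in Ioi (1 : ℝ), s ^ (β - 1) / (s ^ β + A) ^ 3 := hb
      _ ≤ G₃ * (1 / (2 * β)) := mul_le_mul_of_nonneg_left h1 hG₃0
      _ = M₃ / (2 * β) * ((ℓ ^ (2 * 1))⁻¹ * (ℓ ^ 2 / ℓ ^ d)) := by rw [hG₃]; ring
      _ ≤ a₃ * P := by rw [ha₃]; exact mul_le_mul_of_nonneg_left hP3 (by positivity)
      _ ≤ a₃ * P * Aj ^ (-r) := le_mul_of_one_le_right (by positivity) hAjr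
  -- Step 3: assemble
  rw [setIntegral_Ioi_eq_add_add hint hT0.le hT1]
  calc (∫ s in Ioc 0 T, f s) + (∫ s in Ioc T 1, f s) + ∫ s in Ioi 1, f s
      ≤ |∫ s in Ioc 0 T, f s| + |∫ s in Ioc T 1, f s| + |∫ s in Ioi 1, f s| :=
        add_le_add_three (le_abs_self _) (le_abs_self _) (le_abs_self _)
    _ ≤ a₁ * P * Aj ^ (-r) + a₂ * P * Aj ^ (-r) + a₃ * P * Aj ^ (-r) :=
        add_le_add_three hpiece1 hpiece2 hpiece3
    _ = (a₁ + a₂ + a₃) * P * Aj ^ (-r) := by ring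

/-- From the core integral estimate to the derivative: `m² ↦ C_{j;0,x}(m²)` is differentiable at
`m² > 0` and `|∂C_{j;0,x}/∂m²| ≤ c_β · (core bound)` (`c_β = 8 sin πβ/(π(1+cos πβ)²)` from (10.9)).
[cite: Slade2017, §10.1 (proof of Proposition 10.1.1, q = 1)] -/
theorem abs_deriv_fracCov_le_of_core (hd : 1 ≤ d) {α : ℝ} (hα0 : 0 < α) (hα2 : α < 2) {c e : ℝ}
    (hcore : ∀ L : ℝ, 2 ≤ L → ∀ m2 : ℝ, 0 < m2 → ∀ j : ℕ, 1 ≤ j → ∀ x : Site d,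
      m2 * (L ^ (j - 1)) ^ α ≤ 1 →
      ∫ s in Ioi 0, |Gam d L s j x| * (s ^ (α / 2) / (s ^ (α / 2) + m2) ^ 3) ≤
        c * (L ^ (j - 1)) ^ (2 * α - d) * (m2 * (L ^ (j - 1)) ^ α) ^ e) :
    ∀ L : ℝ, 2 ≤ L → ∀ m2 : ℝ, 0 < m2 → ∀ j : ℕ, 1 ≤ j → ∀ x : Site d,
      m2 * (L ^ (j - 1)) ^ α ≤ 1 →
      HasDerivAt (fun a : ℝ => fracCov d L α a j x) (deriv (fun a : ℝ => fracCov d L α a j x) m2) m2 ∧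
      |deriv (fun a : ℝ => fracCov d L α a j x) m2| ≤
        8 * Real.sin (π * (α / 2)) / (π * (1 + Real.cos (π * (α / 2))) ^ 2) * c *
          (L ^ (j - 1)) ^ (2 * α - d) * (m2 * (L ^ (j - 1)) ^ α) ^ e := by
  intro L hL m2 hm2 j hj x hAj
  have hD := (hasDerivAt_fracCov_mass hd hα0 hα2 hL hm2 hj x).2
  refine ⟨hD.differentiableAt.hasDerivAt, ?_⟩
  rw [hD.deriv]
  have hβ0 : 0 < α / 2 := by positivity
  have hβ1 : α / 2 < 1 := by linarith
  have hsin : 0 < Real.sin (π * (α / 2)) := Real.sin_pos_of_pos_of_lt_pi (by positivity)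
    (by nlinarith [Real.pi_pos])
  have hκ := Kato.one_add_cos_pos hβ0 hβ1
  refine (abs_deriv_fracCov_mass_le hd hα0 hα2 hL hm2 hj x).trans ?_
  rw [mul_assoc (8 * Real.sin (π * (α / 2)) / (π * (1 + Real.cos (π * (α / 2))) ^ 2)),
    mul_assoc (8 * Real.sin (π * (α / 2)) / (π * (1 + Real.cos (π * (α / 2))) ^ 2))]
  exact mul_le_mul_of_nonneg_left (hcore L hL m2 hm2 j hj x hAj) (by positivity)

/-- **Proposition 3.3.1 / 10.1.1, the `∂/∂m²` display, `d = 1`** (`a = 0`, on `ℤ¹`): for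
`α ∈ (½,1)` there is `c` (independent of `m², L, j, x`) with
`|∂C_{j;0,x}/∂m²| ≤ c L^{ε(j-1)} (m²L^{α(j-1)})^{-(2-1/α)}` whenever `m² > 0`, `m²L^{α(j-1)} ≤ 1`,
`L ≥ 2`, `j ≥ 1` (`ε = 2α - d`); the derivative exists (`hasDerivAt_fracCov_mass`). Printed: "Let
`d = 1,2,3`. For `m²L^{α(j-1)} ∈ (0,1]`, for `α ∈ (½,1)` when `d = 1`, … `|∂/∂m²∇^aC_{j;x,y}| ≤
cL^{(ε-|a|)(j-1)} × (m²L^{α(j-1)})^{-(2-1/α)}` (`d = 1`)".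
[cite: Slade2017, Proposition 3.3.1 (the ∂/∂m² display, d = 1)] [cite: Slade2017, §10.1 (Proposition 10.1.1 and its proof, q = 1)] -/
theorem Slade2017_prop331_massDeriv_d1 {α : ℝ} (hα0 : 1 / 2 < α) (hα1 : α < 1) :
    ∃ c : ℝ, 0 < c ∧ ∀ L : ℝ, 2 ≤ L → ∀ m2 : ℝ, 0 < m2 → ∀ j : ℕ, 1 ≤ j → ∀ x : Site 1,
      m2 * (L ^ (j - 1)) ^ α ≤ 1 →
      HasDerivAt (fun a : ℝ => fracCov 1 L α a j x) (deriv (fun a : ℝ => fracCov 1 L α a j x) m2) m2 ∧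
      |deriv (fun a : ℝ => fracCov 1 L α a j x) m2| ≤
        c * (L ^ (j - 1)) ^ (2 * α - 1) * (m2 * (L ^ (j - 1)) ^ α) ^ (-(2 - 1 / α)) := by
  -- the `t`-integral of Lemma 10.1.3 for `d = 1`: `θ = ½`
  have hJ₁ : ∀ σ : ℝ, 0 < σ → σ ≤ 1 → ∀ L : ℝ, 1 ≤ L →
      ∫ τ in Ioc (1 / 2 : ℝ) (L / 2), ((1 + σ * τ ^ 2) ^ 1)⁻¹ * (τ ^ 2 / τ ^ 1) / τ ≤
        π / 2 * σ ^ (-(1 / 2 : ℝ)) := by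
    intro σ hσ _ L hL
    have he : EqOn (fun τ : ℝ => ((1 + σ * τ ^ 2) ^ 1)⁻¹ * (τ ^ 2 / τ ^ 1) / τ)
        (fun τ => (1 + σ * τ ^ 2)⁻¹) (Ioc (1 / 2 : ℝ) (L / 2)) := fun τ hτ => by
      have hτ0 : (τ : ℝ) ≠ 0 := by linarith [hτ.1]
      simp only [pow_one]
      field_simp
    rw [setIntegral_congr_fun measurableSet_Ioc he]
    refine (CovBound.setIntegral_inv_one_add_mul_sq_le hσ (by linarith)).trans (le_of_eq ?_)
    rw [Real.sqrt_eq_rpow, Real.rpow_neg hσ.le, div_eq_mul_inv]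
  obtain ⟨c, hc, hcore⟩ := massDeriv_integral_le_core (d := 1) le_rfl (by linarith) (by linarith)
    (θ := 1 / 2) (by norm_num) (by linarith) (by norm_num) (by positivity) hJ₁
  have hconv := abs_deriv_fracCov_le_of_core (d := 1) le_rfl (by linarith) (by linarith) hcore
  have hsin : 0 < Real.sin (π * (α / 2)) := Real.sin_pos_of_pos_of_lt_pi (by positivity)
    (by nlinarith [Real.pi_pos])
  have hκ := Kato.one_add_cos_pos (β := α / 2) (by positivity) (by linarith)
  refine ⟨8 * Real.sin (π * (α / 2)) / (π * (1 + Real.cos (π * (α / 2))) ^ 2) * c, by positivity,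
    fun L hL m2 hm2 j hj x hAj => ?_⟩
  have h := hconv L hL m2 hm2 j hj x hAj
  have he : -(2 - (1 - 1 / 2) / (α / 2)) = -(2 - 1 / α) := by
    field_simp
    ring
  rw [he] at h
  push_cast at h ⊢
  exact h

/-- **Proposition 3.3.1 / 10.1.1, the `∂/∂m²` display, `d = 2`** (`a = 0`, on `ℤ²`), with the
logarithm absorbed into an arbitrarily small power: for `α ∈ (1,2)` and every `θ ∈ (0,1]` there
is `c` (independent of `m², L, j, x`) with `|∂C_{j;0,x}/∂m²| ≤ c L^{ε(j-1)}
(m²L^{α(j-1)})^{-(2-2/α+2θ/α)}` whenever `m² > 0`, `m²L^{α(j-1)} ≤ 1`, `L ≥ 2`, `j ≥ 1`. Printed: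
"`(m²L^{α(j-1)})^{-(2-2/α)}|log(m²L^{α(j-1)})|` (`d = 2`)"; the power form is the one used
downstream ("To deal with the logarithmic factor in (5.23) for `d = 2`, we increase `r` slightly to
absorb it", proof of Lemma 5.2.4), and it is what the corrected `1 + log s⁻¹` form of Lemma 10.1.3
yields through `CovBound.log_le_rpow_neg`.
[cite: Slade2017, Proposition 3.3.1 (the ∂/∂m² display, d = 2)] [cite: Slade2017, §10.1 (Proposition 10.1.1 and its proof, q = 1); Lemma 5.2.4 (proof, "we increase r slightly")] -/
theorem Slade2017_prop331_massDeriv_d2 {α : ℝ} (hα1 : 1 < α) (hα2 : α < 2) {θ : ℝ} (hθ0 : 0 < θ)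
    (hθ1 : θ ≤ 1) :
    ∃ c : ℝ, 0 < c ∧ ∀ L : ℝ, 2 ≤ L → ∀ m2 : ℝ, 0 < m2 → ∀ j : ℕ, 1 ≤ j → ∀ x : Site 2,
      m2 * (L ^ (j - 1)) ^ α ≤ 1 →
      HasDerivAt (fun a : ℝ => fracCov 2 L α a j x) (deriv (fun a : ℝ => fracCov 2 L α a j x) m2) m2 ∧
      |deriv (fun a : ℝ => fracCov 2 L α a j x) m2| ≤
        c * (L ^ (j - 1)) ^ (2 * α - 2) * (m2 * (L ^ (j - 1)) ^ α) ^ (-(2 - 2 / α + 2 * θ / α)) := by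
  -- the `t`-integral of Lemma 10.1.3 for `d = 2`: `1 + log σ⁻¹ ≲ σ^{-θ}`
  have hJ₁ : ∀ σ : ℝ, 0 < σ → σ ≤ 1 → ∀ L : ℝ, 1 ≤ L →
      ∫ τ in Ioc (1 / 2 : ℝ) (L / 2), ((1 + σ * τ ^ 2) ^ 1)⁻¹ * (τ ^ 2 / τ ^ 2) / τ ≤
        5 ^ θ / (2 * θ) * σ ^ (-θ) := by
    intro σ hσ hσ1 L hL
    have he : EqOn (fun τ : ℝ => ((1 + σ * τ ^ 2) ^ 1)⁻¹ * (τ ^ 2 / τ ^ 2) / τ)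
        (fun τ => (τ * (1 + σ * τ ^ 2))⁻¹) (Ioc (1 / 2 : ℝ) (L / 2)) := fun τ hτ => by
      have hτ0 : (τ : ℝ) ≠ 0 := by linarith [hτ.1]
      have hτ2 : (τ : ℝ) ^ 2 ≠ 0 := pow_ne_zero 2 hτ0
      simp only [pow_one]
      field_simp
    rw [setIntegral_congr_fun measurableSet_Ioc he]
    exact (CovBound.setIntegral_inv_mul_one_add_mul_sq_le hσ (by linarith)).trans
      (CovBound.log_le_rpow_neg hσ hσ1 hθ0)
  obtain ⟨c, hc, hcore⟩ := massDeriv_integral_le_core (d := 2) (by norm_num) (by linarith) hα2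
    (θ := θ) hθ0.le (by linarith) hθ1 (by positivity) hJ₁
  have hconv := abs_deriv_fracCov_le_of_core (d := 2) (by norm_num) (by linarith) hα2 hcore
  have hsin : 0 < Real.sin (π * (α / 2)) := Real.sin_pos_of_pos_of_lt_pi (by positivity)
    (by nlinarith [Real.pi_pos])
  have hκ := Kato.one_add_cos_pos (β := α / 2) (by positivity) (by linarith)
  refine ⟨8 * Real.sin (π * (α / 2)) / (π * (1 + Real.cos (π * (α / 2))) ^ 2) * c, by positivity,
    fun L hL m2 hm2 j hj x hAj => ?_⟩
  have h := hconv L hL m2 hm2 j hj x hAj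
  have he : -(2 - (1 - θ) / (α / 2)) = -(2 - 2 / α + 2 * θ / α) := by
    field_simp
    ring
  rw [he] at h
  push_cast at h ⊢
  exact h

/-- **Proposition 3.3.1 / 10.1.1, the `∂/∂m²` display, `d ≥ 3`** (`a = 0`, on `ℤ^d`; printed for
`d = 3`): for `α ∈ (1,2)` there is `c` (independent of `m², L, j, x`) with
`|∂C_{j;0,x}/∂m²| ≤ c L^{ε(j-1)} (m²L^{α(j-1)})^{-(2-2/α)}` whenever `m² > 0`, `m²L^{α(j-1)} ≤ 1`,
`L ≥ 2`, `j ≥ 1`. Printed: "`(m²L^{α(j-1)})^{-(2-2/α)}` (`d = 3`)".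
[cite: Slade2017, Proposition 3.3.1 (the ∂/∂m² display, d = 3)] [cite: Slade2017, §10.1 (Proposition 10.1.1 and its proof, q = 1)] -/
theorem Slade2017_prop331_massDeriv_dge3 (hd : 3 ≤ d) {α : ℝ} (hα1 : 1 < α) (hα2 : α < 2) :
    ∃ c : ℝ, 0 < c ∧ ∀ L : ℝ, 2 ≤ L → ∀ m2 : ℝ, 0 < m2 → ∀ j : ℕ, 1 ≤ j → ∀ x : Site d,
      m2 * (L ^ (j - 1)) ^ α ≤ 1 →
      HasDerivAt (fun a : ℝ => fracCov d L α a j x) (deriv (fun a : ℝ => fracCov d L α a j x) m2) m2 ∧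
      |deriv (fun a : ℝ => fracCov d L α a j x) m2| ≤
        c * (L ^ (j - 1)) ^ (2 * α - d) * (m2 * (L ^ (j - 1)) ^ α) ^ (-(2 - 2 / α)) := by
  have hd1 : 1 ≤ d := by omega
  -- the `t`-integral of Lemma 10.1.3 for `d ≥ 3`: `θ = 0`
  have hJ₁ : ∀ σ : ℝ, 0 < σ → σ ≤ 1 → ∀ L : ℝ, 1 ≤ L →
      ∫ τ in Ioc (1 / 2 : ℝ) (L / 2), ((1 + σ * τ ^ 2) ^ 1)⁻¹ * (τ ^ 2 / τ ^ d) / τ ≤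
        2 ^ (d - 2) * σ ^ (-(0 : ℝ)) := by
    intro σ hσ _ L hL
    rw [neg_zero, Real.rpow_zero, mul_one]
    have hpt : ∀ τ ∈ Ioc (1 / 2 : ℝ) (L / 2),
        ((1 + σ * τ ^ 2) ^ 1)⁻¹ * (τ ^ 2 / τ ^ d) / τ ≤ τ / τ ^ d := by
      intro τ hτ
      have hτ0 : 0 < τ := by linarith [hτ.1]
      have h1 : ((1 + σ * τ ^ 2) ^ 1)⁻¹ ≤ 1 := by
        rw [pow_one]
        apply inv_le_one_of_one_le₀
        nlinarith [mul_nonneg hσ.le (sq_nonneg τ)]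
      have h2 : τ ^ 2 / τ ^ d / τ = τ / τ ^ d := by
        field_simp
      calc ((1 + σ * τ ^ 2) ^ 1)⁻¹ * (τ ^ 2 / τ ^ d) / τ
          = ((1 + σ * τ ^ 2) ^ 1)⁻¹ * (τ ^ 2 / τ ^ d / τ) := by ring
        _ ≤ 1 * (τ ^ 2 / τ ^ d / τ) := mul_le_mul_of_nonneg_right h1 (by positivity)
        _ = τ / τ ^ d := by rw [one_mul, h2]
    calc ∫ τ in Ioc (1 / 2 : ℝ) (L / 2), ((1 + σ * τ ^ 2) ^ 1)⁻¹ * (τ ^ 2 / τ ^ d) / τ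
        ≤ ∫ τ in Ioc (1 / 2 : ℝ) (L / 2), τ / τ ^ d :=
          setIntegral_mono_on (integrableOn_Ioc_of_continuousOn (continuousOn_J_integrand hσ.le 1
            (by norm_num))) (integrableOn_div_pow_Ioc (by norm_num)) measurableSet_Ioc hpt
      _ ≤ 2 ^ (d - 2) := scaleIntegral_le hd hL
  obtain ⟨c, hc, hcore⟩ := massDeriv_integral_le_core hd1 (by linarith) hα2
    (θ := 0) le_rfl (by linarith) (by norm_num) (by positivity) hJ₁
  have hconv := abs_deriv_fracCov_le_of_core hd1 (by linarith) hα2 hcore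
  have hsin : 0 < Real.sin (π * (α / 2)) := Real.sin_pos_of_pos_of_lt_pi (by positivity)
    (by nlinarith [Real.pi_pos])
  have hκ := Kato.one_add_cos_pos (β := α / 2) (by positivity) (by linarith)
  refine ⟨8 * Real.sin (π * (α / 2)) / (π * (1 + Real.cos (π * (α / 2))) ^ 2) * c, by positivity,
    fun L hL m2 hm2 j hj x hAj => ?_⟩
  have h := hconv L hL m2 hm2 j hj x hAj
  have he : -(2 - (1 - 0) / (α / 2)) = -(2 - 2 / α) := by
    field_simp
    ring
  rw [he] at h
  exact h

end FRD

end LongRangePhi4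

end Literature.Barriers.CriticalPhenomena
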